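import Summits.CriticalPhenomena.SAWScalingLimit.Theorems.SAWTotalPositivityCriticalBubbleBoundJoinSides

/-!
# The Madras join assembled (stub `joinPoly_spec` of line `docking-census-joining`)

Crux `stmt-CriticalPhenomena-7117`
(`Summit.CriticalPhenomena.SAWScalingLimit.Theses.SAWTotalPositivity.CriticalBubbleBound`), line
`docking-census-joining` (lead c6, JOIN-MASS programme, wave 3), registered stub `joinPoly_spec`:
the specification of the join arrow `(χ¹, χ², k) ↦ J = joinPoly j m χ¹ χ² k` of `…JoinSurgeryDefs`
(N. Madras' joining procedure as recalled and used by A. Hammond, Ann. Probab. 46 (2018)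
= arXiv:1808.09032, §4.1 and Definition 4.3).

**The assembly.** With `τ = P(χ¹)`, the partner `σ'` at first contact, the window `Y`
(`contact_window_facts`: free zones, window vertices, partner rows `≥ k ≥ 3`, a partner vertex on the
tip row of `τ`): the right corridor of `Y` is free of `τ` and the left corridor free of `σ'`, so
`modify_uniform` applies to `τ` (giving `τ̃`) and `sigma_side` to `σ'` (giving `σ̂`, the rotated
modification translated by the spacer `T₂ = outOff τ + outOff σ + 1`); the two are vertex-disjoint
(old/old by the free zone at distance `T₂ ≥ 5`, old/new and new/old by the free zones around the two
window vertices, new/new by columns), `τ̃ ∋ {q, q+e₁}` and `σ̂ ∋ {q+e₀, q+e₀+e₁}` for the junction corner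
`q = Y + (outOff τ, 0)`, and `flipV_merge` joins them: `J` is a polygon with `j + m + 18` edges whose
un-joining flip at the join plaquette `q` is `τ̃ ∪ σ̂`. Moreover `σ̂` lives on rows `≥ 1`, the root edge
endpoint `e₀` survives in `τ̃` (`isV_modify_e₀`), and a partner vertex on the tip row of `τ` — or one of
its polygon-neighbours — survives in `σ̂` at abscissa `≥ xmax τ + 5`, two columns beyond `τ̃`.
-/

noncomputable section

open SimpleGraph
open Literature.Probability.LatticeModels
open Literature.Probability.RandomPlanarGeometry Literature.Probability.RandomPlanarGeometry.SAW
open scoped BigOperators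
open Summit.CriticalPhenomena.SAWScalingLimit.Theorems.CriticalBubbleBound.Negative (e₀)
open Summit.CriticalPhenomena.SAWScalingLimit.Theorems.CriticalBubbleBound.Docking

namespace Summit.CriticalPhenomena.SAWScalingLimit.Theorems.CriticalBubbleBound.Join

/-! ## Coordinates -/

/-- Two sites of `ℤ²` with equal coordinates are equal. [folklore] -/
private theorem site_eq {x y : Site 2} (h0 : x 0 = y 0) (h1 : x 1 = y 1) : x = y :=
  funext (Fin.forall_fin_two.2 ⟨h0, h1⟩)

/-- Coordinates of `pt Y (a, b) = Y + (a, b)`. [folklore] -/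
private theorem pt_mk_apply (Y : Site 2) (a b : ℤ) :
    pt Y (a, b) 0 = Y 0 + a ∧ pt Y (a, b) 1 = Y 1 + b := by
  simp [pt]

/-- Coordinates of `x + (s, t)`. [folklore] -/
private theorem vadd_apply (x : Site 2) (s t : ℤ) :
    (x + ![s, t]) 0 = x 0 + s ∧ (x + ![s, t]) 1 = x 1 + t := ⟨rfl, rfl⟩

/-- Coordinates of `x - (s, t)`. [folklore] -/
private theorem vsub_apply (x : Site 2) (s t : ℤ) :
    (x - ![s, t]) 0 = x 0 - s ∧ (x - ![s, t]) 1 = x 1 - t := ⟨rfl, rfl⟩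

/-- A vertex in the vertical 3-window of `Y`, given as `Y + (0, t)` with `|t| ≤ 1`. [folklore] -/
private theorem window_of_vadd {V : Finset (Site 2)} {Y : Site 2} {t : ℤ} (h1 : -1 ≤ t) (h2 : t ≤ 1)
    (h : Y + ![0, t] ∈ V) : Y - e₁ ∈ V ∨ Y ∈ V ∨ Y + e₁ ∈ V := by
  obtain ⟨-, -, k0, k1⟩ := e₀_e₁_apply
  obtain ⟨f0, f1⟩ := vadd_apply Y 0 t
  rcases (by omega : t = -1 ∨ t = 0 ∨ t = 1) with rfl | rfl | rfl
  · refine Or.inl ?_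
    convert h using 1
    exact site_eq (by rw [f0, Pi.sub_apply, k0]; omega) (by rw [f1, Pi.sub_apply, k1]; omega)
  · refine Or.inr (Or.inl ?_)
    convert h using 1
    exact site_eq (by rw [f0]; omega) (by rw [f1]; omega)
  · refine Or.inr (Or.inr ?_)
    convert h using 1
    exact site_eq (by rw [f0, Pi.add_apply, k0]) (by rw [f1, Pi.add_apply, k1])

/-! ## Local structure of a polygon at a vertex -/

/-- An edge of a polygon of `ℤ²` is a lattice edge. [folklore] -/
private theorem adj_of_mem {E : Finset (Sym2 (Site 2))} (hE : IsPolygon (zdGraph 2) E)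
    {a b : Site 2} (h : s(a, b) ∈ E) : (zdGraph 2).Adj a b := by
  obtain ⟨u, c, -, rfl⟩ := hE
  exact c.adj_of_mem_edges (List.mem_toFinset.1 h)

/-- A vertex of a polygon (the edge set of a cycle) has two distinct polygon-neighbours. [folklore] -/
private theorem exists_two_nbrs {E : Finset (Sym2 (Site 2))} (hE : IsPolygon (zdGraph 2) E)
    {v : Site 2} (hv : IsV E v) : ∃ x x' : Site 2, x ≠ x' ∧ s(v, x) ∈ E ∧ s(v, x') ∈ E := by
  obtain ⟨u, c, hc, rfl⟩ := hE
  obtain ⟨e, he, hve⟩ := hv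
  have hvs : v ∈ c.support :=
    (Walk.mem_support_iff_exists_mem_edges_of_not_nil hc.not_nil).2 ⟨e, List.mem_toFinset.1 he, hve⟩
  obtain ⟨x, x', hne, hN⟩ := Set.ncard_eq_two.1 (hc.ncard_neighborSet_toSubgraph_eq_two hvs)
  have hx : ∀ w, w ∈ ({x, x'} : Set (Site 2)) → s(v, w) ∈ c.edges.toFinset := by
    intro w hw
    rw [← hN, Subgraph.mem_neighborSet, Walk.adj_toSubgraph_iff_mem_edges] at hw
    exact List.mem_toFinset.2 hw
  exact ⟨x, x', hne, hx x (Set.mem_insert _ _), hx x' (Set.mem_insert_of_mem _ rfl)⟩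

/-! ## The partner reaches two columns beyond the modified polygon -/

/-- **Far right.** If the partner polygon `S` has a vertex on the tip row of `P(χ)` and the strip left
of every vertex of `P(χ)` is free of `S`, then that vertex — or, if it is the one vertex `x₀` the
partner's modification may drop, one of its two polygon-neighbours — has abscissa `≥ xmax χ`, so its
translate by `T ≥ 5` on `N ⊇ (S ∖ {x₀}) + (T, 0)` lies two columns beyond every vertex of `M`, whose
vertices are vertices of `P(χ)` or have abscissa `≤ Y 0 + 3 ≤ xmax χ + 3`. [folklore] -/
private theorem far_right {j : ℕ} {χ : ℕ → Site 2} {S M N : Finset (Sym2 (Site 2))} {Y x₀ : Site 2}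
    {T o : ℤ} (hS : IsPolygon (zdGraph 2) S) (hT : 5 ≤ T) (ho : o ≤ 3)
    (hF2 : ∀ a ∈ verts j χ, ∀ s t : ℤ, 1 ≤ s → -2 ≤ t → t ≤ 2 → ¬ IsV S (a + ![-s, t]))
    (htip : ∃ b : Site 2, IsV S b ∧ b 1 = tipRow j χ) (hY : ∃ a ∈ verts j χ, a 0 = Y 0)
    (hM : ∀ p : Site 2, IsV M p → p ∈ verts j χ ∨ p 0 ≤ Y 0 + o)
    (hsurv : ∀ w : Site 2, IsV S w → w ≠ x₀ → IsV N (w + ![T, 0])) :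
    ∃ v : Site 2, IsV N v ∧ ∀ x : Site 2, IsV M x → x 0 + 2 ≤ v 0 := by
  obtain ⟨b, hb, hb1⟩ := htip
  obtain ⟨r, hr, hr1⟩ := exists_eq_tipRow j χ
  obtain ⟨hrV, hr0⟩ := mem_rightCol.1 hr
  obtain ⟨k0, -, k2, -⟩ := e₀_e₁_apply
  -- the tip-row vertex of `S` is weakly right of the rightmost column of `P(χ)`
  have hbr : r 0 ≤ b 0 := by
    by_contra hlt
    refine hF2 r hrV (r 0 - b 0) 0 (by omega) (by norm_num) (by norm_num) ?_
    convert hb using 2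
    obtain ⟨f0, f1⟩ := vadd_apply r (-(r 0 - b 0)) 0
    exact site_eq (by omega) (by omega)
  -- the vertices of `M` have abscissa `≤ xmax + 3`
  have hMx : ∀ x : Site 2, IsV M x → x 0 ≤ r 0 + 3 := by
    intro x hx
    obtain ⟨a, ha, ha0⟩ := hY
    have ha' := (bounds_of_mem_verts ha).2.1
    rcases hM x hx with h | h
    · have := (bounds_of_mem_verts h).2.1
      omega
    · omega
  suffices hw : ∃ w : Site 2, IsV S w ∧ w ≠ x₀ ∧ r 0 ≤ w 0 by
    obtain ⟨w, hw, hne, hw0⟩ := hw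
    refine ⟨w + ![T, 0], hsurv w hw hne, fun x hx => ?_⟩
    have h1 := hMx x hx
    have h2 := (vadd_apply w T 0).1
    omega
  by_cases hbx : b = x₀
  · -- `b` may be dropped: use one of its two polygon-neighbours
    obtain ⟨x, x', hne, hx, hx'⟩ := exists_two_nbrs hS hb
    have hxa := adj_of_mem hS hx
    have hxa' := adj_of_mem hS hx'
    have key : ∀ w : Site 2, (zdGraph 2).Adj b w → w ≠ b - e₀ → b 0 ≤ w 0 := by
      intro w hw hwne
      rcases adj_cases hw with rfl | rfl | rfl | rfl
      · rw [Pi.add_apply, k0]; omega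
      · exact absurd rfl hwne
      · rw [Pi.add_apply, k2]; omega
      · rw [Pi.sub_apply, k2]; omega
    by_cases hxe : x = b - e₀
    · refine ⟨x', ⟨_, hx', Sym2.mem_mk_right _ _⟩, fun h => hxa'.ne (hbx.trans h.symm), ?_⟩
      exact hbr.trans (key x' hxa' fun h => hne (hxe.trans h.symm))
    · exact ⟨x, ⟨_, hx, Sym2.mem_mk_right _ _⟩, fun h => hxa.ne (hbx.trans h.symm),
        hbr.trans (key x hxa hxe)⟩
  · exact ⟨b, hb, hbx, hbr⟩

/-! ## The assembly -/

/-- The join assembled from the two sides (all contact/window facts as hypotheses; `S` is the partner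
at first contact). [cite: Hammond2015SAPJoining, Definition 4.3] -/
private theorem core {j m : ℕ} {χ₁ : ℕ → Site 2} {k : ℤ} (S : Finset (Sym2 (Site 2))) (Y : Site 2)
    (hχ₁ : χ₁ ∈ lexRooted j) (hj : 3 ≤ j) (hS : IsPolygon (zdGraph 2) S) (hSc : S.card = m + 1)
    (hk : 3 ≤ k)
    (hF1 : ∀ b : Site 2, IsV S b → ∀ s t : ℤ, 1 ≤ s → -2 ≤ t → t ≤ 2 → b + ![s, t] ∉ verts j χ₁)
    (hF2 : ∀ a ∈ verts j χ₁, ∀ s t : ℤ, 1 ≤ s → -2 ≤ t → t ≤ 2 → ¬ IsV S (a + ![-s, t]))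
    (hwτ : ∃ t : ℤ, -1 ≤ t ∧ t ≤ 1 ∧ Y + ![0, t] ∈ verts j χ₁)
    (hwσ : ∃ t : ℤ, -1 ≤ t ∧ t ≤ 1 ∧ IsV S (Y + ![0, t]))
    (hrows : ∀ b : Site 2, IsV S b → k ≤ b 1) (htip : ∃ b : Site 2, IsV S b ∧ b 1 = tipRow j χ₁) :
    IsPolygon (zdGraph 2) (flipV (modify (pedges j χ₁) Y ∪
        trE ![spacer (caseOf (pedges j χ₁) Y) (caseOf (rotE Y S) Y), 0] (rotE Y (modify (rotE Y S) Y)))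
        (pt Y (outOff (caseOf (pedges j χ₁) Y), 0))) ∧
      (flipV (modify (pedges j χ₁) Y ∪
        trE ![spacer (caseOf (pedges j χ₁) Y) (caseOf (rotE Y S) Y), 0] (rotE Y (modify (rotE Y S) Y)))
        (pt Y (outOff (caseOf (pedges j χ₁) Y), 0))).card = j + m + 18 ∧
      IsJoinPlaq (flipV (modify (pedges j χ₁) Y ∪
        trE ![spacer (caseOf (pedges j χ₁) Y) (caseOf (rotE Y S) Y), 0] (rotE Y (modify (rotE Y S) Y)))
        (pt Y (outOff (caseOf (pedges j χ₁) Y), 0))) (pt Y (outOff (caseOf (pedges j χ₁) Y), 0)) ∧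
      IsPolygon (zdGraph 2) (modify (pedges j χ₁) Y) ∧
      IsPolygon (zdGraph 2)
        (trE ![spacer (caseOf (pedges j χ₁) Y) (caseOf (rotE Y S) Y), 0] (rotE Y (modify (rotE Y S) Y))) ∧
      (∀ x : Site 2, IsV (modify (pedges j χ₁) Y) x →
        IsV (trE ![spacer (caseOf (pedges j χ₁) Y) (caseOf (rotE Y S) Y), 0]
          (rotE Y (modify (rotE Y S) Y))) x → False) ∧
      flipH (flipV (modify (pedges j χ₁) Y ∪
        trE ![spacer (caseOf (pedges j χ₁) Y) (caseOf (rotE Y S) Y), 0] (rotE Y (modify (rotE Y S) Y)))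
        (pt Y (outOff (caseOf (pedges j χ₁) Y), 0))) (pt Y (outOff (caseOf (pedges j χ₁) Y), 0)) =
        modify (pedges j χ₁) Y ∪
          trE ![spacer (caseOf (pedges j χ₁) Y) (caseOf (rotE Y S) Y), 0] (rotE Y (modify (rotE Y S) Y)) ∧
      (∀ x : Site 2, IsV (trE ![spacer (caseOf (pedges j χ₁) Y) (caseOf (rotE Y S) Y), 0]
        (rotE Y (modify (rotE Y S) Y))) x → 1 ≤ x 1) ∧
      IsV (modify (pedges j χ₁) Y) e₀ ∧
      (∃ v : Site 2, IsV (trE ![spacer (caseOf (pedges j χ₁) Y) (caseOf (rotE Y S) Y), 0]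
        (rotE Y (modify (rotE Y S) Y))) v ∧ ∀ x : Site 2, IsV (modify (pedges j χ₁) Y) x → x 0 + 2 ≤ v 0) ∧
      unmodify (caseOf (pedges j χ₁) Y) (modify (pedges j χ₁) Y) Y = pedges j χ₁ ∧
      unmodify (caseOf (rotE Y S) Y) (modify (rotE Y S) Y) Y = rotE Y S := by
  have hsaw := lexRooted_subset j hχ₁
  have hτP : IsPolygon (zdGraph 2) (pedges j χ₁) := isPolygon_pedges j χ₁ hsaw hj
  have hτc : (pedges j χ₁).card = j + 1 := card_pedges hsaw (by omega)
  have hVτ : ∀ x : Site 2, IsV (pedges j χ₁) x ↔ x ∈ verts j χ₁ := fun x => exists_mem_pedges_iff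
  obtain ⟨tτ, htτ1, htτ2, haτ⟩ := hwτ
  obtain ⟨tσ, htσ1, htσ2, hbσ⟩ := hwσ
  have hY1 : 2 ≤ Y 1 := by
    have h1 := hrows _ hbσ
    have h2 := (vadd_apply Y 0 tσ).2
    omega
  -- the two corridors and the two windows
  have hcorτ : ∀ s t : ℤ, 1 ≤ s → -1 ≤ t → t ≤ 1 → ¬ IsV (pedges j χ₁) (Y + ![s, t]) := by
    intro s t hs ht1 ht2 h
    rw [hVτ] at h
    refine hF1 _ hbσ s (t - tσ) hs (by omega) (by omega) ?_
    convert h using 1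
    obtain ⟨f0, f1⟩ := vadd_apply (Y + ![0, tσ]) s (t - tσ)
    obtain ⟨g0, g1⟩ := vadd_apply Y 0 tσ
    obtain ⟨h0, h1⟩ := vadd_apply Y s t
    exact site_eq (by omega) (by omega)
  have hcorσ : ∀ s t : ℤ, 1 ≤ s → -1 ≤ t → t ≤ 1 → ¬ IsV S (Y + ![-s, t]) := by
    intro s t hs ht1 ht2 h
    refine hF2 _ haτ s (t - tτ) hs (by omega) (by omega) ?_
    convert h using 1
    obtain ⟨f0, f1⟩ := vadd_apply (Y + ![0, tτ]) (-s) (t - tτ)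
    obtain ⟨g0, g1⟩ := vadd_apply Y 0 tτ
    obtain ⟨h0, h1⟩ := vadd_apply Y (-s) t
    exact site_eq (by omega) (by omega)
  have hwinτ : IsV (pedges j χ₁) (Y - e₁) ∨ IsV (pedges j χ₁) Y ∨ IsV (pedges j χ₁) (Y + e₁) := by
    rw [hVτ, hVτ, hVτ]
    exact window_of_vadd htτ1 htτ2 haτ
  have hwinσ : IsV S (Y - e₁) ∨ IsV S Y ∨ IsV S (Y + e₁) := by
    have h := window_of_vadd (V := vxs S) htσ1 htσ2 (mem_vxs.2 hbσ)
    rwa [mem_vxs, mem_vxs, mem_vxs] at h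
  -- the two sides
  obtain ⟨hτ1, hτ2, -, hτ4, hτ5, ⟨a₁, ha₁V, ha₁0, ha₁1, ha₁1', hτ6⟩, hτ7, hτ8⟩ :=
    modify_uniform (pedges j χ₁) Y hτP hcorτ hwinτ
  have he₀ := isV_modify_e₀ hχ₁ hj hY1 hcorτ hτ7
  obtain ⟨hσ1, hσ2, hσ3, hσ4, ⟨b₁, hb₁V, hb₁0, hb₁1, hb₁1', hσ5⟩, ⟨x₀, hσ6⟩, hσ7⟩ :=
    sigma_side S Y (spacer (caseOf (pedges j χ₁) Y) (caseOf (rotE Y S) Y)) hS hcorσ hwinσ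
  have hT : spacer (caseOf (pedges j χ₁) Y) (caseOf (rotE Y S) Y) =
      outOff (caseOf (pedges j χ₁) Y) + outOff (caseOf (rotE Y S) Y) + 1 := rfl
  have hoτ := outOff_eq (caseOf (pedges j χ₁) Y)
  have hoσ := outOff_eq (caseOf (rotE Y S) Y)
  rw [hVτ] at ha₁V
  -- vertex-disjointness
  have hdisj : ∀ x : Site 2, IsV (modify (pedges j χ₁) Y) x →
      IsV (trE ![spacer (caseOf (pedges j χ₁) Y) (caseOf (rotE Y S) Y), 0]
        (rotE Y (modify (rotE Y S) Y))) x → False := by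
    intro x hx hx'
    rcases hτ6 x hx with h | ⟨c1, c2, c3, c4⟩ <;> rcases hσ5 x hx' with h' | ⟨d1, d2, d3, d4⟩
    · rw [hVτ] at h
      refine hF1 _ h' (spacer (caseOf (pedges j χ₁) Y) (caseOf (rotE Y S) Y)) 0 (by omega)
        (by norm_num) (by norm_num) ?_
      rwa [sub_add_cancel]
    · rw [hVτ] at h
      refine hF1 _ hb₁V (x 0 - Y 0) (x 1 - b₁ 1) (by omega) (by omega) (by omega) ?_
      convert h using 1
      obtain ⟨f0, f1⟩ := vadd_apply b₁ (x 0 - Y 0) (x 1 - b₁ 1)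
      exact site_eq (by omega) (by omega)
    · refine hF2 _ ha₁V (Y 0 + spacer (caseOf (pedges j χ₁) Y) (caseOf (rotE Y S) Y) - x 0)
        (x 1 - a₁ 1) (by omega) (by omega) (by omega) ?_
      convert h' using 2
      obtain ⟨f0, f1⟩ := vadd_apply a₁ (-(Y 0 + spacer (caseOf (pedges j χ₁) Y) (caseOf (rotE Y S) Y) - x 0))
        (x 1 - a₁ 1)
      obtain ⟨g0, g1⟩ := vsub_apply x (spacer (caseOf (pedges j χ₁) Y) (caseOf (rotE Y S) Y)) 0
      exact site_eq (by omega) (by omega)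
    · omega
  -- the two vertical sides of the junction plaquette
  obtain ⟨k0, k1, k2, k3⟩ := e₀_e₁_apply
  obtain ⟨q0, q1⟩ := pt_mk_apply Y (outOff (caseOf (pedges j χ₁) Y)) 0
  have hlf : s(pt Y (outOff (caseOf (pedges j χ₁) Y), 0), pt Y (outOff (caseOf (pedges j χ₁) Y), 0) + e₁) ∈
      modify (pedges j χ₁) Y := by
    convert hτ4 using 3
    obtain ⟨f0, f1⟩ := pt_mk_apply Y (outOff (caseOf (pedges j χ₁) Y)) 1
    exact site_eq (by rw [Pi.add_apply, k2]; omega) (by rw [Pi.add_apply, k3]; omega)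
  have hrt : s(pt Y (outOff (caseOf (pedges j χ₁) Y), 0) + e₀,
      pt Y (outOff (caseOf (pedges j χ₁) Y), 0) + e₀ + e₁) ∈
      trE ![spacer (caseOf (pedges j χ₁) Y) (caseOf (rotE Y S) Y), 0] (rotE Y (modify (rotE Y S) Y)) := by
    convert hσ3 using 3
    · obtain ⟨f0, f1⟩ := pt_mk_apply Y
        (spacer (caseOf (pedges j χ₁) Y) (caseOf (rotE Y S) Y) - outOff (caseOf (rotE Y S) Y)) 0
      exact site_eq (by rw [Pi.add_apply, k0]; omega) (by rw [Pi.add_apply, k1]; omega)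
    · obtain ⟨f0, f1⟩ := pt_mk_apply Y
        (spacer (caseOf (pedges j χ₁) Y) (caseOf (rotE Y S) Y) - outOff (caseOf (rotE Y S) Y)) 1
      exact site_eq (by rw [Pi.add_apply, Pi.add_apply, k0, k2]; omega)
        (by rw [Pi.add_apply, Pi.add_apply, k1, k3]; omega)
  obtain ⟨hJ1, hJ2, hJ3, hJ4⟩ := flipV_merge _ _ _ hτ1 hσ1 hdisj hlf hrt
  refine ⟨hJ1, by omega, hJ3, hτ1, hσ1, hdisj, hJ4, fun x hx => ?_, he₀, ?_, hτ8, hσ7⟩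
  · -- the partner lives on rows `≥ 1`
    rcases hσ5 x hx with h' | ⟨-, -, d3, -⟩
    · have h1 := hrows _ h'
      have h2 := (vsub_apply x (spacer (caseOf (pedges j χ₁) Y) (caseOf (rotE Y S) Y)) 0).2
      omega
    · have h1 := hrows _ hb₁V
      omega
  · -- the partner reaches two columns beyond `τ̃`
    refine far_right (o := outOff (caseOf (pedges j χ₁) Y)) hS (by omega) (by omega) hF2 htip
      ⟨a₁, ha₁V, ha₁0⟩ (fun p hp => ?_) hσ6
    rcases hτ6 p hp with h | ⟨-, c2, -, -⟩
    · exact Or.inl ((hVτ p).1 h)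
    · exact Or.inr c2

/-- **Stub `joinPoly_spec` (the Madras join assembled).** For lex-rooted classes `χ¹ ∈ lexRooted j`,
`χ² ∈ lexRooted m` (`j, m ≥ 3`) and an admissible offset `k`, with `τ = P(χ¹)`, the partner
`σ' = P(χ²) + (T*, k)` at first contact, the window `Y`, the modified polygon `τ̃ = modify τ Y`, the
partner's rotated-back modification translated by the spacer `σ̂`, the junction corner `q` and the join
`J = flipV (τ̃ ∪ σ̂) q`: `J` is a polygon with `j + m + 18` edges; the plaquette at `q` is a join plaquette
of `J`; `τ̃` and `σ̂` are vertex-disjoint polygons with `flipH J q = τ̃ ∪ σ̂`; `σ̂` lives on rows `≥ 1`;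
`e₀` is a vertex of `τ̃`; some vertex of `σ̂` lies two columns beyond every vertex of `τ̃`; and the two
modifications are inverted by `unmodify` with the recorded case tags.
[cite: Hammond2015SAPJoining, Definition 4.3 (Madras joinable polygons and their join)] -/
theorem joinPoly_spec : ∀ (j m : ℕ) (χ₁ χ₂ : ℕ → Site 2) (k : ℤ), χ₁ ∈ lexRooted j → χ₂ ∈ lexRooted m → 3 ≤ j → 3 ≤ m → k ∈ offsets j m χ₁ χ₂ →
    IsPolygon (zdGraph 2) (joinPoly j m χ₁ χ₂ k) ∧ (joinPoly j m χ₁ χ₂ k).card = j + m + 18 ∧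
    IsJoinPlaq (joinPoly j m χ₁ χ₂ k) (joinCorner j m χ₁ χ₂ k) ∧
    IsPolygon (zdGraph 2) (modify (pedges j χ₁) (joinY j m χ₁ χ₂ k)) ∧
    IsPolygon (zdGraph 2) (trE ![spacer (caseOf (pedges j χ₁) (joinY j m χ₁ χ₂ k)) (caseR (pedges m (shift (sigmaShift j m χ₁ χ₂ k) χ₂)) (joinY j m χ₁ χ₂ k)), 0] (modifyR (pedges m (shift (sigmaShift j m χ₁ χ₂ k) χ₂)) (joinY j m χ₁ χ₂ k))) ∧
    (∀ x : Site 2, IsV (modify (pedges j χ₁) (joinY j m χ₁ χ₂ k)) x → IsV (trE ![spacer (caseOf (pedges j χ₁) (joinY j m χ₁ χ₂ k)) (caseR (pedges m (shift (sigmaShift j m χ₁ χ₂ k) χ₂)) (joinY j m χ₁ χ₂ k)), 0] (modifyR (pedges m (shift (sigmaShift j m χ₁ χ₂ k) χ₂)) (joinY j m χ₁ χ₂ k))) x → False) ∧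
    flipH (joinPoly j m χ₁ χ₂ k) (joinCorner j m χ₁ χ₂ k) = modify (pedges j χ₁) (joinY j m χ₁ χ₂ k) ∪ trE ![spacer (caseOf (pedges j χ₁) (joinY j m χ₁ χ₂ k)) (caseR (pedges m (shift (sigmaShift j m χ₁ χ₂ k) χ₂)) (joinY j m χ₁ χ₂ k)), 0] (modifyR (pedges m (shift (sigmaShift j m χ₁ χ₂ k) χ₂)) (joinY j m χ₁ χ₂ k)) ∧
    (∀ x : Site 2, IsV (trE ![spacer (caseOf (pedges j χ₁) (joinY j m χ₁ χ₂ k)) (caseR (pedges m (shift (sigmaShift j m χ₁ χ₂ k) χ₂)) (joinY j m χ₁ χ₂ k)), 0] (modifyR (pedges m (shift (sigmaShift j m χ₁ χ₂ k) χ₂)) (joinY j m χ₁ χ₂ k))) x → 1 ≤ x 1) ∧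
    IsV (modify (pedges j χ₁) (joinY j m χ₁ χ₂ k)) e₀ ∧
    (∃ v : Site 2, IsV (trE ![spacer (caseOf (pedges j χ₁) (joinY j m χ₁ χ₂ k)) (caseR (pedges m (shift (sigmaShift j m χ₁ χ₂ k) χ₂)) (joinY j m χ₁ χ₂ k)), 0] (modifyR (pedges m (shift (sigmaShift j m χ₁ χ₂ k) χ₂)) (joinY j m χ₁ χ₂ k))) v ∧ ∀ x : Site 2, IsV (modify (pedges j χ₁) (joinY j m χ₁ χ₂ k)) x → x 0 + 2 ≤ v 0) ∧
    unmodify (caseOf (pedges j χ₁) (joinY j m χ₁ χ₂ k)) (modify (pedges j χ₁) (joinY j m χ₁ χ₂ k)) (joinY j m χ₁ χ₂ k) = pedges j χ₁ ∧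
    unmodify (caseR (pedges m (shift (sigmaShift j m χ₁ χ₂ k) χ₂)) (joinY j m χ₁ χ₂ k)) (modify (rotE (joinY j m χ₁ χ₂ k) (pedges m (shift (sigmaShift j m χ₁ χ₂ k) χ₂))) (joinY j m χ₁ χ₂ k)) (joinY j m χ₁ χ₂ k) = rotE (joinY j m χ₁ χ₂ k) (pedges m (shift (sigmaShift j m χ₁ χ₂ k) χ₂)) := by
  intro j m χ₁ χ₂ k hχ₁ hχ₂ hj hm hk
  obtain ⟨-, hF1, hF2, hwτ, ⟨tσ, htσ1, htσ2, hbσ⟩, -, hrows, ⟨bt, hbt, hbt1⟩⟩ :=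
    contact_window_facts j m χ₁ χ₂ k hχ₁ hχ₂ hj hm hk
  have hsaw₂ := lexRooted_subset m hχ₂
  obtain ⟨hS, hSc⟩ := pedges_shift_isPolygon hsaw₂ (by omega) (sigmaShift j m χ₁ χ₂ k)
  have hV : ∀ x : Site 2, IsV (pedges m (shift (sigmaShift j m χ₁ χ₂ k) χ₂)) x ↔
      x ∈ verts m (shift (sigmaShift j m χ₁ χ₂ k) χ₂) := fun x => exists_mem_pedges_iff
  exact core (pedges m (shift (sigmaShift j m χ₁ χ₂ k) χ₂)) (joinY j m χ₁ χ₂ k) hχ₁ hj hS hSc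
    (mem_offsets.1 hk).1 (fun b hb => hF1 b ((hV b).1 hb))
    (fun a ha s t hs ht1 ht2 h => hF2 a ha s t hs ht1 ht2 ((hV _).1 h))
    hwτ ⟨tσ, htσ1, htσ2, (hV _).2 hbσ⟩ (fun b hb => hrows b ((hV b).1 hb))
    ⟨bt, (hV bt).2 hbt, hbt1⟩

end Summit.CriticalPhenomena.SAWScalingLimit.Theorems.CriticalBubbleBound.Join

end
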